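import Literature.Geometry.Kaehler.SiegelTorusThetaCharacteristicTransitive
import Literature.Geometry.Kaehler.SiegelTorusThetaGradientModular
import HarnessLib

/-!
# The `2^{g−1}(2^g+1)` theta-null divisors `θ_{null,m} ⊂ 𝔥_g` and the `2^{g−1}(2^g−1)` gradient loci
# `{grad_z ϑ[m](0, Z) = 0}` are each a single `Γ_g`-orbit ("they are all conjugate under `Γ_g`")

Layer `Literature/Geometry/Kaehler`, namespace `Literature.Geometry.Kaehler.ComplexTorus` (lane
`lit-hodgefound`, Layer A4, theta-divisor row A4-17; prover seat `lit-hodgefound-p23`, row «A4-17(x)»).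
Sequel of `SiegelTorusThetaCharacteristicTransitive.lean` (`Γ_g` is transitive on the even and on the
odd characteristics), `SiegelTorusThetaCharacteristicAction.lean` (`γ_M p ∈ vanishingThetaNulls (M·Z) ↔
p ∈ vanishingThetaNulls Z`) and `SiegelTorusThetaGradientModular.lean` (`memGradThetaNullAt_moeb_iff`).

Sources followed (held texts, read at the quoted lines). S. Grushevsky, R. Salvati Manni, *Jacobians
with a vanishing theta-null in genus 4* (2008) [held `paper:arxiv-math_0605160` p0004, Definition 6]:
`θ_null = {τ | ∃ m even, θ_m(τ) = 0}` on `𝒜_g`, the image of the components `{θ_m = 0} ⊂ 𝓗_g`;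
S. Grushevsky, R. Salvati Manni, *Singularities of the theta divisor at points of order two* (2009)
[held `paper:arxiv-0805.4148` p0010 L37–L41]: "`(∂θ)_null` is the union of such projections over all odd
`[ε,δ]`, but they are all conjugate under `Γ_g`" [and p0009 L38: "the symplectic group acts
transitively … on the odd characteristics"]. With the transformation formula of theta constants /
gradients under `Γ_g` (rows A4-17(q),(s),(t)) and the transitivity of row A4-17(v), for two characteristics
of the same parity there is `M ∈ Sp_{2g}(ℤ)` carrying the locus of the one onto the locus of the other.

What is here (theorems only; no definition, no named fact, net debt `0`).

* **`exists_symplectic_thetaConst_eq_zero_iff_of_even`**: for `ᵗkl`, `ᵗk₂l₂` even there is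
  `M ∈ Sp_{2g}(ℤ)` with `ϑ[k₂/2; l₂/2](0, M·Z) = 0 ↔ ϑ[k/2; l/2](0, Z) = 0` for all `Z ∈ 𝔥_g`;
  **`exists_symplectic_thetaNullComponent_eq_image`**: `{Z ∈ 𝔥_g | ϑ[k₂/2;l₂/2](0,Z) = 0} = M·{Z ∈ 𝔥_g | ϑ[k/2;l/2](0,Z) = 0}`.
* **`exists_symplectic_memGradThetaNullAt_iff_of_odd`**: for `ᵗkl`, `ᵗk₂l₂` odd there is `M` with
  `Z ∈ {grad ϑ[k/2;l/2](0,·) = 0} ↔ M·Z ∈ {grad ϑ[k₂/2;l₂/2](0,·) = 0}`;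
  **`exists_symplectic_gradThetaNullComponent_eq_image`** (the image form).
* `moeb_symplectic_surjOn` (`M⁻¹` provides preimages in `𝔥_g`).

## References

* [GrushevskySalvatiManni2008] S. Grushevsky, R. Salvati Manni, *Jacobians with a vanishing theta-null
  in genus 4*, Israel J. Math. 164 (2008), Definition 6 (p0004 of the held text).
* [GrushevskySalvatiManni2009HighMultiplicity] S. Grushevsky, R. Salvati Manni, *Singularities of the theta
  divisor at points of order two*, IMRN (2007) (arXiv:0805.4148), p0009 L38 and p0010 L37–L41 of the held text.
* [GrushevskySalvatiManni2004Gradients] S. Grushevsky, R. Salvati Manni, *Gradients of odd theta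
  functions* (2004), p0003 L77–L110 of the held text.
* [Lange2023AbelianVarietiesComplex] H. Lange, *Abelian Varieties over the Complex Numbers* (2023),
  §3.1.3 Prop. 3.1.6, §3.3.3 Thm. 3.3.9.
-/

noncomputable section

open scoped Manifold Topology
open scoped Real
open Set Function Complex Matrix Filter
open Literature.Analysis.SpecialFunctions Literature.Analysis.Complex

namespace Literature.Geometry.Kaehler

namespace ComplexTorus

open Literature.NumberTheory.Automorphic (siegelUpperHalfSpace)
open Literature.NumberTheory.ModularForms.SiegelUpperHalfSpace (moeb denom moeb_mul moeb_one)

variable {n : ℕ}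

/-! ### §1 `M⁻¹` provides preimages: `Z ↦ M·Z` maps `𝔥_g` onto `𝔥_g` -/

section Surj

/-- **`M·(M⁻¹·W) = W`** on `𝔥_g` for `M ∈ Sp_{2g}(ℤ)`.
[cite: Lange2023AbelianVarietiesComplex, §3.1.3 Prop. 3.1.6 (p0160)] -/
theorem moeb_symplectic_moeb_inv (M : Matrix.symplecticGroup (Fin n) ℤ) {W : Matrix (Fin n) (Fin n) ℂ}
    (hW : W ∈ siegelUpperHalfSpace n) :
    moeb ((M : Matrix (Fin n ⊕ Fin n) (Fin n ⊕ Fin n) ℤ).map ((↑) : ℤ → ℂ))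
        (moeb (((M⁻¹ : Matrix.symplecticGroup (Fin n) ℤ) : Matrix (Fin n ⊕ Fin n) (Fin n ⊕ Fin n) ℤ).map
          ((↑) : ℤ → ℂ)) W) = W := by
  have hmul : (((M * M⁻¹ : Matrix.symplecticGroup (Fin n) ℤ) :
      Matrix (Fin n ⊕ Fin n) (Fin n ⊕ Fin n) ℤ).map ((↑) : ℤ → ℂ)) =
      (M : Matrix (Fin n ⊕ Fin n) (Fin n ⊕ Fin n) ℤ).map ((↑) : ℤ → ℂ) *
        (((M⁻¹ : Matrix.symplecticGroup (Fin n) ℤ) : Matrix (Fin n ⊕ Fin n) (Fin n ⊕ Fin n) ℤ).map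
          ((↑) : ℤ → ℂ)) := by
    rw [Submonoid.coe_mul]
    exact Matrix.map_mul (f := Int.castRingHom ℂ)
  rw [← moeb_mul (isUnit_det_denom_intCast (M⁻¹).2 hW), ← hmul, mul_inv_cancel, Submonoid.coe_one,
    Matrix.map_one _ Int.cast_zero Int.cast_one, moeb_one]

/-- **`Z ↦ M·Z` maps `𝔥_g` onto `𝔥_g`** (`M ∈ Sp_{2g}(ℤ)`).
[cite: Lange2023AbelianVarietiesComplex, §3.1.3 Prop. 3.1.6 (p0160)] -/
theorem moeb_symplectic_surjOn (M : Matrix.symplecticGroup (Fin n) ℤ) :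
    Set.SurjOn (moeb ((M : Matrix (Fin n ⊕ Fin n) (Fin n ⊕ Fin n) ℤ).map ((↑) : ℤ → ℂ)))
      (siegelUpperHalfSpace n) (siegelUpperHalfSpace n) := fun W hW ↦
  ⟨moeb (((M⁻¹ : Matrix.symplecticGroup (Fin n) ℤ) : Matrix (Fin n ⊕ Fin n) (Fin n ⊕ Fin n) ℤ).map
      ((↑) : ℤ → ℂ)) W, moeb_intCast_mem (M⁻¹).2 hW, moeb_symplectic_moeb_inv M hW⟩

/-- From a pointwise equivalence `P(M·Z) ↔ Q(Z)` on `𝔥_g` to the image statement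
`{Z ∈ 𝔥_g | P Z} = M·{Z ∈ 𝔥_g | Q Z}`. [folklore] -/
private theorem setOf_eq_image_of_forall_iff (M : Matrix.symplecticGroup (Fin n) ℤ)
    {P Q : Matrix (Fin n) (Fin n) ℂ → Prop}
    (h : ∀ Z ∈ siegelUpperHalfSpace n,
      P (moeb ((M : Matrix (Fin n ⊕ Fin n) (Fin n ⊕ Fin n) ℤ).map ((↑) : ℤ → ℂ)) Z) ↔ Q Z) :
    {Z | Z ∈ siegelUpperHalfSpace n ∧ P Z} =
      moeb ((M : Matrix (Fin n ⊕ Fin n) (Fin n ⊕ Fin n) ℤ).map ((↑) : ℤ → ℂ)) ''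
        {Z | Z ∈ siegelUpperHalfSpace n ∧ Q Z} := by
  ext W
  simp only [Set.mem_setOf_eq, Set.mem_image]
  constructor
  · rintro ⟨hW, hPW⟩
    obtain ⟨Z, hZ, rfl⟩ := moeb_symplectic_surjOn M hW
    exact ⟨Z, ⟨hZ, (h Z hZ).1 hPW⟩, rfl⟩
  · rintro ⟨Z, ⟨hZ, hQZ⟩, rfl⟩
    exact ⟨moeb_intCast_mem M.2 hZ, (h Z hZ).2 hQZ⟩

end Surj

/-! ### §2 The theta-null divisors `{ϑ[m](0, ·) = 0}` (`m` even) are `Γ_g`-conjugate -/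

section Even

/-- The parity of an integral class as a `ZMod 2` sum. [folklore] -/
private theorem sum_sumElim_intCast (k l : Fin n → ℤ) :
    ∑ i, Sum.elim (fun i ↦ (k i : ZMod 2)) (fun i ↦ (l i : ZMod 2)) (Sum.inl i) *
        Sum.elim (fun i ↦ (k i : ZMod 2)) (fun i ↦ (l i : ZMod 2)) (Sum.inr i) =
      ∑ i, (k i : ZMod 2) * (l i : ZMod 2) := by
  simp only [Sum.elim_inl, Sum.elim_inr]

/-- **The theta-null divisors of two even characteristics are `Γ_g`-conjugate (pointwise form)**: for
`k, l, k₂, l₂ ∈ ℤ^g` with `ᵗkl`, `ᵗk₂l₂` even there is `M ∈ Sp_{2g}(ℤ)` such that for every `Z ∈ 𝔥_g`,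
`ϑ[k₂/2; l₂/2](0, M·Z) = 0 ↔ ϑ[k/2; l/2](0, Z) = 0`.
[cite: GrushevskySalvatiManni2008, Definition 6 (p0004 of the held text)]
[cite: GrushevskySalvatiManni2004Gradients, p0003 L77–L110 of the held text] -/
theorem exists_symplectic_thetaConst_eq_zero_iff_of_even (k l k₂ l₂ : Fin n → ℤ) (h : Even (k ⬝ᵥ l))
    (h₂ : Even (k₂ ⬝ᵥ l₂)) :
    ∃ M : Matrix.symplecticGroup (Fin n) ℤ, ∀ Z ∈ siegelUpperHalfSpace n,
      riemannThetaChar (fun i ↦ (k₂ i : ℂ) / 2) (fun i ↦ (l₂ i : ℂ) / 2)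
          (moeb ((M : Matrix (Fin n ⊕ Fin n) (Fin n ⊕ Fin n) ℤ).map ((↑) : ℤ → ℂ)) Z) 0 = 0 ↔
        riemannThetaChar (fun i ↦ (k i : ℂ) / 2) (fun i ↦ (l i : ℂ) / 2) Z 0 = 0 := by
  have hp : ∑ i, Sum.elim (fun i ↦ (k i : ZMod 2)) (fun i ↦ (l i : ZMod 2)) (Sum.inl i) *
      Sum.elim (fun i ↦ (k i : ZMod 2)) (fun i ↦ (l i : ZMod 2)) (Sum.inr i) = 0 := by
    rw [sum_sumElim_intCast, sum_intCast_mul_intCast_eq_zero_iff]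
    exact h
  have hq : ∑ i, Sum.elim (fun i ↦ (k₂ i : ZMod 2)) (fun i ↦ (l₂ i : ZMod 2)) (Sum.inl i) *
      Sum.elim (fun i ↦ (k₂ i : ZMod 2)) (fun i ↦ (l₂ i : ZMod 2)) (Sum.inr i) = 0 := by
    rw [sum_sumElim_intCast, sum_intCast_mul_intCast_eq_zero_iff]
    exact h₂
  obtain ⟨M, hM⟩ := exists_symplecticCharAction_apply_eq_of_even hp hq
  refine ⟨M, fun Z hZ ↦ ?_⟩
  have key := symplecticCharPerm_mem_vanishingThetaNulls_iff M.2 hZ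
    (Sum.elim (fun i ↦ (k i : ZMod 2)) (fun i ↦ (l i : ZMod 2)))
  rw [← symplecticCharAction_apply, hM, sumElim_intCast_mem_vanishingThetaNulls_iff,
    sumElim_intCast_mem_vanishingThetaNulls_iff] at key
  exact ⟨fun h0 ↦ (key.1 ⟨h₂, h0⟩).2, fun h0 ↦ (key.2 ⟨h, h0⟩).2⟩

/-- **The theta-null divisors of two even characteristics are `Γ_g`-conjugate (image form)**:
`{Z ∈ 𝔥_g | ϑ[k₂/2; l₂/2](0, Z) = 0} = M · {Z ∈ 𝔥_g | ϑ[k/2; l/2](0, Z) = 0}` for some `M ∈ Sp_{2g}(ℤ)`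
— so `θ_null ⊂ 𝒜_g` is the image of ANY one of the `2^{g−1}(2^g+1)` divisors `{θ_m = 0} ⊂ 𝔥_g`.
[cite: GrushevskySalvatiManni2008, Definition 6 (p0004 of the held text)]
[cite: GrushevskySalvatiManni2004Gradients, p0003 L77–L110 of the held text] -/
theorem exists_symplectic_thetaNullComponent_eq_image (k l k₂ l₂ : Fin n → ℤ) (h : Even (k ⬝ᵥ l))
    (h₂ : Even (k₂ ⬝ᵥ l₂)) :
    ∃ M : Matrix.symplecticGroup (Fin n) ℤ,
      {Z | Z ∈ siegelUpperHalfSpace n ∧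
          riemannThetaChar (fun i ↦ (k₂ i : ℂ) / 2) (fun i ↦ (l₂ i : ℂ) / 2) Z 0 = 0} =
        moeb ((M : Matrix (Fin n ⊕ Fin n) (Fin n ⊕ Fin n) ℤ).map ((↑) : ℤ → ℂ)) ''
          {Z | Z ∈ siegelUpperHalfSpace n ∧
            riemannThetaChar (fun i ↦ (k i : ℂ) / 2) (fun i ↦ (l i : ℂ) / 2) Z 0 = 0} := by
  obtain ⟨M, hM⟩ := exists_symplectic_thetaConst_eq_zero_iff_of_even k l k₂ l₂ h h₂
  exact ⟨M, setOf_eq_image_of_forall_iff M hM⟩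

end Even

/-! ### §3 The gradient loci `{grad_z ϑ[m](0, ·) = 0}` (`m` odd) are `Γ_g`-conjugate -/

section Odd

/-- Congruent integral characteristics have the same gradient locus. [cite: GrushevskySalvatiManni2009HighMultiplicity, p0003 L75 of the held text] -/
private theorem memGradThetaNullAt_iff_of_intCast_eq {k l k₂ l₂ : Fin n → ℤ}
    (hk : (fun i ↦ (k i : ZMod 2)) = fun i ↦ (k₂ i : ZMod 2))
    (hl : (fun i ↦ (l i : ZMod 2)) = fun i ↦ (l₂ i : ZMod 2)) (Ω : Matrix (Fin n) (Fin n) ℂ) :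
    MemGradThetaNullAt k₂ l₂ Ω ↔ MemGradThetaNullAt k l Ω := by
  have hd : ∀ i, ∃ d : ℤ, k₂ i = k i + 2 * d := fun i ↦ by
    obtain ⟨d, hd⟩ := (ZMod.intCast_eq_intCast_iff_dvd_sub (k i) (k₂ i) 2).1 (congrFun hk i)
    exact ⟨d, by omega⟩
  have hd' : ∀ i, ∃ d : ℤ, l₂ i = l i + 2 * d := fun i ↦ by
    obtain ⟨d, hd⟩ := (ZMod.intCast_eq_intCast_iff_dvd_sub (l i) (l₂ i) 2).1 (congrFun hl i)
    exact ⟨d, by omega⟩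
  choose d hd using hd
  choose d' hd' using hd'
  have hk₂ : k₂ = fun i ↦ k i + 2 * d i := funext hd
  have hl₂ : l₂ = fun i ↦ l i + 2 * d' i := funext hd'
  rw [hk₂, hl₂]
  exact memGradThetaNullAt_add_two_mul_iff Ω k l d d'

/-- **The gradient loci of two odd characteristics are `Γ_g`-conjugate (pointwise form)**: for
`ᵗkl`, `ᵗk₂l₂` odd there is `M ∈ Sp_{2g}(ℤ)` such that for every `Z ∈ 𝔥_g`,
`grad_z ϑ[k₂/2; l₂/2](0, M·Z) = 0 ↔ grad_z ϑ[k/2; l/2](0, Z) = 0` ("they are all conjugate under `Γ_g`").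
[cite: GrushevskySalvatiManni2009HighMultiplicity, p0010 L37–L41 and p0009 L38 of the held text] -/
theorem exists_symplectic_memGradThetaNullAt_iff_of_odd (k l k₂ l₂ : Fin n → ℤ) (h : Odd (k ⬝ᵥ l))
    (h₂ : Odd (k₂ ⬝ᵥ l₂)) :
    ∃ M : Matrix.symplecticGroup (Fin n) ℤ, ∀ Z ∈ siegelUpperHalfSpace n,
      MemGradThetaNullAt k₂ l₂ (moeb ((M : Matrix (Fin n ⊕ Fin n) (Fin n ⊕ Fin n) ℤ).map ((↑) : ℤ → ℂ)) Z) ↔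
        MemGradThetaNullAt k l Z := by
  have hp : ∑ i, Sum.elim (fun i ↦ (k i : ZMod 2)) (fun i ↦ (l i : ZMod 2)) (Sum.inl i) *
      Sum.elim (fun i ↦ (k i : ZMod 2)) (fun i ↦ (l i : ZMod 2)) (Sum.inr i) = 1 := by
    rw [sum_sumElim_intCast, sum_intCast_mul_intCast_eq_one_iff]
    exact h
  have hq : ∑ i, Sum.elim (fun i ↦ (k₂ i : ZMod 2)) (fun i ↦ (l₂ i : ZMod 2)) (Sum.inl i) *
      Sum.elim (fun i ↦ (k₂ i : ZMod 2)) (fun i ↦ (l₂ i : ZMod 2)) (Sum.inr i) = 1 := by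
    rw [sum_sumElim_intCast, sum_intCast_mul_intCast_eq_one_iff]
    exact h₂
  obtain ⟨M, hM⟩ := exists_symplecticCharAction_apply_eq_of_odd hp hq
  refine ⟨M, fun Z hZ ↦ ?_⟩
  -- `γ_M(k̄; l̄) = (k̄'; l̄')` with Lange's integral `(k', l')`, and `= (k̄₂; l̄₂)` by the choice of `M`
  have hperm := symplecticCharPerm_sumElim_intCast M.2 k l
  rw [← symplecticCharAction_apply, hM] at hperm
  have hk := congrArg (fun f : Fin n ⊕ Fin n → ZMod 2 ↦ fun i ↦ f (Sum.inl i)) hperm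
  have hl := congrArg (fun f : Fin n ⊕ Fin n → ZMod 2 ↦ fun i ↦ f (Sum.inr i)) hperm
  simp only [Sum.elim_inl, Sum.elim_inr] at hk hl
  rw [← memGradThetaNullAt_moeb_iff M.2 hZ k l]
  exact (memGradThetaNullAt_iff_of_intCast_eq hk hl _).symm

/-- **The gradient loci of two odd characteristics are `Γ_g`-conjugate (image form)**:
`{Z ∈ 𝔥_g | grad_z ϑ[k₂/2; l₂/2](0, Z) = 0} = M · {Z ∈ 𝔥_g | grad_z ϑ[k/2; l/2](0, Z) = 0}` for some
`M ∈ Sp_{2g}(ℤ)` — so `(∂θ)_null ⊂ 𝒜_g` is the image of ANY one of the `2^{g−1}(2^g−1)` loci.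
[cite: GrushevskySalvatiManni2009HighMultiplicity, p0010 L37–L41 of the held text] -/
theorem exists_symplectic_gradThetaNullComponent_eq_image (k l k₂ l₂ : Fin n → ℤ) (h : Odd (k ⬝ᵥ l))
    (h₂ : Odd (k₂ ⬝ᵥ l₂)) :
    ∃ M : Matrix.symplecticGroup (Fin n) ℤ,
      {Z | Z ∈ siegelUpperHalfSpace n ∧ MemGradThetaNullAt k₂ l₂ Z} =
        moeb ((M : Matrix (Fin n ⊕ Fin n) (Fin n ⊕ Fin n) ℤ).map ((↑) : ℤ → ℂ)) ''
          {Z | Z ∈ siegelUpperHalfSpace n ∧ MemGradThetaNullAt k l Z} := by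
  obtain ⟨M, hM⟩ := exists_symplectic_memGradThetaNullAt_iff_of_odd k l k₂ l₂ h h₂
  exact ⟨M, setOf_eq_image_of_forall_iff M hM⟩

end Odd

end ComplexTorus

end Literature.Geometry.Kaehler

end
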